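import Literature.MathematicalPhysics.QuantumLattice.LiebWuRangeMonotone
import Mathlib.MeasureTheory.Integral.IntegralEqImproper
import HarnessLib

/-!
# Lieb–Wu 2003, Theorem 2: the magnetisation `M/N` and the rapidity range `B`

Family `hubbard`. Lieb–Wu, PRL 20 (1968) 1445, statement (b): "`M/N` is a monotonically increasing
function of `B` reaching a maximum of `½` at `B = ∞`. This is the antiferromagnetic case, `S_z = 0`, and
corresponds to the absolute ground state." Physica A 321 (2003) 1, §5, THEOREM 2 (Monotonicity in `B`):
"When `B` increases with `Q` fixed, `N/N_a` and `M/N` increase. When `B = ∞`, we have `2M = N`, and when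
`B < ∞` we have `2M < N` (for all `Q`)." Its proof integrates (14) over `ℝ` using `∫K = 1`:
`N/N_a = ∫_{-Q}^{Q} ρ = ∫_{-∞}^{∞} σ + ∫_{-B}^{B} σ`, i.e. (eq. (lemma1))
`1 = 2 M/N + (N_a/N)[∫_{-∞}^{-B} + ∫_{B}^{∞}] σ`, "the integrals decrease as `B` increases by Lemma 1 and
converge to `0` as `B → ∞` … If `B < ∞` then `M/N < 1/2` since `σ` is a strictly positive function."

For the Neumann-series solution `(ρ_S, σ_S)` (`liebWuRhoAtS`, `liebWuSigmaAtS`; by Theorem 1 THE solution)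
with filling `N/N_a = liebWuFilling Q ρ_S` (15) and down-spin density `M/N_a = liebWuDownSpinDensity S σ_S`
(16), this file PROVES:

* `liebWuFilling_eq_integral_add_downSpin`: `N/N_a = ∫_ℝ σ_S + ∫_S σ_S` for every measurable range `S`;
* `two_mul_downSpin_add_tail`: `2 M/N_a + ∫_{Sᶜ} σ_S = N/N_a` (eq. (lemma1) times `N/N_a`);
* `two_mul_downSpin_lt_filling_Icc`: **`B < ∞ ⇒ 2M < N`**; `two_mul_downSpin_eq_filling_univ`: **`B = ∞ ⇒ 2M = N`**;
* `liebWuFilling_liebWuRhoAtS_ge`: `N/N_a ≥ ∫σ_S ≥ ∫ξ = Q/2π > 0`;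
* `tail_antitone`: the tail integral `∫_{|Λ|>B} σ_B` decreases in `B` (Lemma 1) and `tendsto_tail_zero`:
  tends to `0` as `B → ∞`; hence `tendsto_magnetisation_half`: **`M/N → ½` as `B → ∞`**.

NOT treated here: the monotonicity of `N/N_a` and of `M/N` in `B`, which in the printed proof uses Lemma 2
(`f` increases with `B`, via the operator `Û = K̂B̂(1 + K̂²B̂)⁻¹K̂`). No named fact.

## References

* E. H. Lieb, F. Y. Wu, Physica A 321 (2003) 1–27 = arXiv:cond-mat/0207529, §5, Theorem 2 and eq.
  (lemma1), Lemma 1 (key `LiebWuPhysicaA2003`); PRL 20 (1968) 1445, eqs. (15)–(16), statement (b)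
  (`LiebWuPRL1968`).
-/

noncomputable section

open MeasureTheory Set Real Filter intervalIntegral
open Literature.Analysis.SpecialFunctions
open scoped Convolution Topology

namespace Literature.MathematicalPhysics.QuantumLattice

namespace LiebWuMagnet

variable {f g : ℝ → ℝ} {B : ℝ}

/-- `∫∫ f(t) g(x - t) dt dx = (∫ f)(∫ g)`. [folklore] -/
private theorem integral_conv₆ (hf : Integrable f) (hg : Integrable g) :
    ∫ x, ∫ t, f t * g (x - t) = (∫ t, f t) * ∫ y, g y := by
  have h : (fun x => ∫ t, f t * g (x - t)) = f ⋆[ContinuousLinearMap.mul ℝ ℝ, volume] g := by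
    funext x; rw [convolution_def]; simp only [ContinuousLinearMap.mul_apply']
  rw [h, integral_convolution (L := ContinuousLinearMap.mul ℝ ℝ) hf hg]; rfl

/-- `0 ≤ ∫ f(t) g(x - t) dt ≤ B ∫ f` for `f, g ≥ 0`, `g ≤ B`, `f ∈ L¹`. [folklore] -/
private theorem conv_nonneg_le₆ (hf : Integrable f) (hf0 : ∀ t, 0 ≤ f t) (hg0 : ∀ y, 0 ≤ g y)
    (hgB : ∀ y, g y ≤ B) (x : ℝ) :
    0 ≤ ∫ t, f t * g (x - t) ∧ ∫ t, f t * g (x - t) ≤ B * ∫ t, f t := by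
  refine ⟨integral_nonneg fun t => mul_nonneg (hf0 t) (hg0 _), ?_⟩
  rw [← MeasureTheory.integral_const_mul]
  refine integral_mono_of_nonneg (Eventually.of_forall fun t => mul_nonneg (hf0 t) (hg0 _))
    (hf.const_mul B) (Eventually.of_forall fun t => ?_)
  dsimp only
  rw [mul_comm B]
  exact mul_le_mul_of_nonneg_left (hgB _) (hf0 t)

end LiebWuMagnet

open LiebWuMagnet

section Theorem2

variable {U Q : ℝ} {S : Set ℝ}

/-- A global bound for the momentum density: `|ρ_S(k)| ≤ 1/2π + (1/(πc)) ∫σ_S`, `c = U/4`.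
[cite: LiebWuPhysicaA2003, §5, Theorem 1] -/
theorem abs_liebWuRhoAtS_le (hU : 0 < U) (hQ : 0 < Q) (hS : MeasurableSet S) (k : ℝ) :
    |liebWuRhoAtS U Q S k| ≤ 1 / (2 * π) + 1 / (π * (U / 4)) * ∫ t, liebWuSigmaAtS U Q S t := by
  have hc : 0 < U / 4 := by positivity
  have hσi := integrable_liebWuSigmaAtS hU hQ hS
  have hσ0 : ∀ t, 0 ≤ S.indicator (liebWuSigmaAtS U Q S) t := fun t =>
    indicator_nonneg (fun s _ => (liebWuSigmaAtS_pos hU hQ hS s).le) _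
  have hG := conv_nonneg_le₆ (hσi.indicator hS) hσ0 (fun y => (cauchyDensity_pos hc y).le)
    (cauchyDensity_le hc) (Real.sin k)
  have hind : ∫ t, S.indicator (liebWuSigmaAtS U Q S) t ≤ ∫ t, liebWuSigmaAtS U Q S t :=
    integral_mono (hσi.indicator hS) hσi fun t =>
      indicator_le_self' (fun s _ => (liebWuSigmaAtS_pos hU hQ hS s).le) t
  rw [liebWuRhoAtS]
  calc |1 / (2 * π) + Real.cos k * ∫ t, S.indicator (liebWuSigmaAtS U Q S) t * cauchyDensity (U / 4) (Real.sin k - t)|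
      ≤ |1 / (2 * π)| + |Real.cos k * ∫ t, S.indicator (liebWuSigmaAtS U Q S) t *
          cauchyDensity (U / 4) (Real.sin k - t)| := abs_add_le _ _
    _ ≤ 1 / (2 * π) + 1 * (1 / (π * (U / 4)) * ∫ t, liebWuSigmaAtS U Q S t) := by
        rw [abs_of_pos (by positivity : (0:ℝ) < 1 / (2 * π)), abs_mul]
        refine add_le_add le_rfl (mul_le_mul (Real.abs_cos_le_one k) ?_ (abs_nonneg _) zero_le_one)
        rw [abs_of_nonneg hG.1]
        exact hG.2.trans (mul_le_mul_of_nonneg_left hind (by positivity))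
    _ = _ := by rw [one_mul]

/-- **Integrating (14) over `ℝ` (`∫K = ∫K² = 1`): `N/N_a = ∫_{-Q}^{Q} ρ = ∫_{-∞}^{∞} σ + ∫_S σ`** — the
identity behind eq. (lemma1), for every measurable range `S`. [cite: LiebWuPhysicaA2003, §5, proof of Theorem 2] -/
theorem liebWuFilling_eq_integral_add_downSpin (hU : 0 < U) (hQ : 0 < Q) (hQπ : Q ≤ π) (hS : MeasurableSet S) :
    liebWuFilling Q (liebWuRhoAtS U Q S) =
      (∫ Λ, liebWuSigmaAtS U Q S Λ) + liebWuDownSpinDensity S (liebWuSigmaAtS U Q S) := by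
  have hc : 0 < U / 4 := by positivity
  have h2c : 0 < U / 2 := by positivity
  set σ := liebWuSigmaAtS U Q S with hσ
  set ρ := liebWuRhoAtS U Q S with hρ
  have hσi : Integrable σ := integrable_liebWuSigmaAtS hU hQ hS
  have hσSi : Integrable (S.indicator σ) := hσi.indicator hS
  have hρc : Continuous ρ := continuous_liebWuRhoAtS hU hQ hS
  have hKc : Continuous (cauchyDensity (U / 4)) := continuous_cauchyDensity hc
  have hKi : Integrable (cauchyDensity (U / 4)) := integrable_cauchyDensity hc.le
  have hK2i : Integrable (cauchyDensity (U / 2)) := integrable_cauchyDensity h2c.le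
  -- the finite measure `dk|_{(-Q,Q]}` and the first term of (14) as a product integral
  set m : Measure ℝ := volume.restrict (Ioc (-Q) Q) with hm
  haveI : IsFiniteMeasure m := by rw [hm]; infer_instance
  obtain ⟨C, hC⟩ : ∃ C, ∀ k, |ρ k| ≤ C := ⟨_, abs_liebWuRhoAtS_le hU hQ hS⟩
  have hprod : Integrable (fun p : ℝ × ℝ => ρ p.2 * cauchyDensity (U / 4) (p.1 - Real.sin p.2)) (volume.prod m) := by
    have h1 := integrable_comp_sub_prod (m := m) hKc hKi Real.continuous_sin
    exact h1.bdd_mul ((hρc.comp continuous_snd).aestronglyMeasurable) (c := C)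
      (Eventually.of_forall fun p => by rw [Real.norm_eq_abs]; exact hC _)
  have hT : ∀ Λ, (∫ k in -Q..Q, cauchyDensity (U / 4) (Λ - Real.sin k) * ρ k) =
      ∫ k, ρ k * cauchyDensity (U / 4) (Λ - Real.sin k) ∂m := by
    intro Λ
    rw [intervalIntegral.integral_of_le (by linarith), hm]
    exact MeasureTheory.integral_congr_ae (Eventually.of_forall fun k => mul_comm _ _)
  have hI1 : ∫ Λ, (∫ k in -Q..Q, cauchyDensity (U / 4) (Λ - Real.sin k) * ρ k) = liebWuFilling Q ρ := by
    simp_rw [hT]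
    rw [integral_integral_swap hprod]
    have hinner : ∀ k, ∫ Λ, ρ k * cauchyDensity (U / 4) (Λ - Real.sin k) = ρ k := by
      intro k
      rw [MeasureTheory.integral_const_mul, integral_sub_right_eq_self (cauchyDensity (U / 4)) (Real.sin k),
        integral_cauchyDensity hc, mul_one]
    simp_rw [hinner]
    rw [liebWuFilling, intervalIntegral.integral_of_le (by linarith), hm]
  -- the second term: `∫ (1_S σ ∗ K²) = ∫_S σ`
  have hI2 : ∫ Λ, ∫ Λ' in S, cauchyDensity (U / 2) (Λ - Λ') * σ Λ' = liebWuDownSpinDensity S σ := by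
    have hrw : ∀ Λ, ∫ Λ' in S, cauchyDensity (U / 2) (Λ - Λ') * σ Λ' = ∫ t, S.indicator σ t * cauchyDensity (U / 2) (Λ - t) := by
      intro Λ
      rw [← MeasureTheory.integral_indicator hS]
      refine MeasureTheory.integral_congr_ae (Eventually.of_forall fun t => ?_)
      beta_reduce
      by_cases ht : t ∈ S
      · rw [indicator_of_mem ht, indicator_of_mem ht, mul_comm]
      · rw [indicator_of_notMem ht, indicator_of_notMem ht, zero_mul]
    simp_rw [hrw]
    rw [integral_conv₆ hσSi hK2i, integral_cauchyDensity h2c, mul_one, liebWuDownSpinDensity,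
      MeasureTheory.integral_indicator hS]
  -- integrate the kernel form of (14)
  have hker : ∀ Λ, σ Λ = (∫ k in -Q..Q, cauchyDensity (U / 4) (Λ - Real.sin k) * ρ k) -
      ∫ Λ' in S, cauchyDensity (U / 2) (Λ - Λ') * σ Λ' := liebWuSigmaAtS_eq_kernel_form hU hQ hQπ hS
  have hi1 : Integrable fun Λ => ∫ k in -Q..Q, cauchyDensity (U / 4) (Λ - Real.sin k) * ρ k := by
    have := hprod.integral_prod_left
    refine this.congr (Eventually.of_forall fun Λ => ?_)
    simp only [hT]
  have hi2 : Integrable fun Λ => ∫ Λ' in S, cauchyDensity (U / 2) (Λ - Λ') * σ Λ' := by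
    have h := (hi1.sub hσi)
    refine h.congr (Eventually.of_forall fun Λ => ?_)
    simp only [Pi.sub_apply]
    linarith [hker Λ]
  have hint : ∫ Λ, σ Λ = (∫ Λ, ∫ k in -Q..Q, cauchyDensity (U / 4) (Λ - Real.sin k) * ρ k) -
      ∫ Λ, ∫ Λ' in S, cauchyDensity (U / 2) (Λ - Λ') * σ Λ' := by
    rw [← integral_sub hi1 hi2]
    exact MeasureTheory.integral_congr_ae (Eventually.of_forall hker)
  rw [hI1, hI2] at hint
  linarith

/-- **Eq. (lemma1), multiplied by `N/N_a`: `2 M/N_a + ∫_{Sᶜ} σ_S = N/N_a`.** [cite: LiebWuPhysicaA2003, §5, eq. (lemma1)] -/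
theorem two_mul_downSpin_add_tail (hU : 0 < U) (hQ : 0 < Q) (hQπ : Q ≤ π) (hS : MeasurableSet S) :
    2 * liebWuDownSpinDensity S (liebWuSigmaAtS U Q S) + ∫ Λ in Sᶜ, liebWuSigmaAtS U Q S Λ =
      liebWuFilling Q (liebWuRhoAtS U Q S) := by
  have hσi : Integrable (liebWuSigmaAtS U Q S) := integrable_liebWuSigmaAtS hU hQ hS
  rw [liebWuFilling_eq_integral_add_downSpin hU hQ hQπ hS, liebWuDownSpinDensity,
    ← integral_add_compl hS hσi]
  ring

/-- **`N/N_a > 0`**: indeed `N/N_a ≥ ∫σ_S ≥ ∫ξ = Q/2π`. [cite: LiebWuPhysicaA2003, §5, Theorem 2] -/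
theorem liebWuFilling_liebWuRhoAtS_ge (hU : 0 < U) (hQ : 0 < Q) (hQπ : Q ≤ π) (hS : MeasurableSet S) :
    Q / (2 * π) ≤ liebWuFilling Q (liebWuRhoAtS U Q S) := by
  have hσi : Integrable (liebWuSigmaAtS U Q S) := integrable_liebWuSigmaAtS hU hQ hS
  obtain ⟨hξi, hξint⟩ := integrable_liebWuXi_and_integral hU hQ
  have h1 : Q / (2 * π) ≤ ∫ Λ, liebWuSigmaAtS U Q S Λ := by
    rw [← hξint]; exact integral_mono hξi hσi (liebWuXi_le_liebWuSigmaAtS hU hQ hS)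
  have h2 : 0 ≤ liebWuDownSpinDensity S (liebWuSigmaAtS U Q S) :=
    setIntegral_nonneg hS fun t _ => (liebWuSigmaAtS_pos hU hQ hS t).le
  rw [liebWuFilling_eq_integral_add_downSpin hU hQ hQπ hS]
  linarith

/-- **Theorem 2, `B < ∞ ⇒ 2M < N`** ("since `σ` is a strictly positive function"): for the range `[-B, B]`
(any real `B`), `2 · M/N_a < N/N_a`. [cite: LiebWuPhysicaA2003, §5, Theorem 2] -/
theorem two_mul_downSpin_lt_filling_Icc (hU : 0 < U) (hQ : 0 < Q) (hQπ : Q ≤ π) (B : ℝ) :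
    2 * liebWuDownSpinDensity (Icc (-B) B) (liebWuSigmaAtS U Q (Icc (-B) B)) <
      liebWuFilling Q (liebWuRhoAtS U Q (Icc (-B) B)) := by
  have hS : MeasurableSet (Icc (-B) B) := measurableSet_Icc
  set σ := liebWuSigmaAtS U Q (Icc (-B) B) with hσ
  have hσi : Integrable σ := integrable_liebWuSigmaAtS hU hQ hS
  have hσc : Continuous σ := continuous_liebWuSigmaAtS hU hQ hS
  have hσpos : ∀ t, 0 < σ t := liebWuSigmaAtS_pos hU hQ hS
  rw [← two_mul_downSpin_add_tail hU hQ hQπ hS]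
  -- the tail integral is positive: it dominates `∫_{(B, B+1]} σ > 0`
  have hsub : Ioc B (B + 1) ⊆ (Icc (-B) B)ᶜ := fun t ht hmem => by
    simp only [mem_Ioc, mem_Icc] at ht hmem; linarith
  have hpos : 0 < ∫ t in Ioc B (B + 1), σ t := by
    rw [← intervalIntegral.integral_of_le (by linarith : B ≤ B + 1)]
    exact intervalIntegral_pos_of_pos (hσc.intervalIntegrable _ _) hσpos (by linarith)
  have hmono : ∫ t in Ioc B (B + 1), σ t ≤ ∫ t in (Icc (-B) B)ᶜ, σ t :=
    setIntegral_mono_set hσi.integrableOn (Eventually.of_forall fun t => (hσpos t).le)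
      (Eventually.of_forall hsub)
  linarith

/-- **Theorem 2, `B = ∞ ⇒ 2M = N`:** for the range `ℝ`, `2 · M/N_a = N/N_a` (the absolute ground state has
`S_z = 0`; cf. `liebWuFillingAtCutoff_eq_two_mul_integral_sigma` in `LiebWuFillingIdentity`).
[cite: LiebWuPhysicaA2003, §5, Theorem 2] -/
theorem two_mul_downSpin_eq_filling_univ (hU : 0 < U) (hQ : 0 < Q) (hQπ : Q ≤ π) :
    2 * liebWuDownSpinDensity univ (liebWuSigmaAtS U Q univ) = liebWuFilling Q (liebWuRhoAtS U Q univ) := by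
  rw [← two_mul_downSpin_add_tail hU hQ hQπ MeasurableSet.univ, compl_univ, Measure.restrict_empty,
    integral_zero_measure, add_zero]

/-- **Statement (b) for an arbitrary solution with `B < ∞`: `M/N < ½`.** [cite: LiebWuPRL1968, statement (b)] -/
theorem IsLiebWuDensities.two_mul_downSpin_lt_filling (hU : 0 < U) {B : ℝ} (hB : 0 < B) {ρ σ : ℝ → ℝ}
    (h : IsLiebWuDensities U Q (Icc (-B) B) ρ σ) :
    2 * liebWuDownSpinDensity (Icc (-B) B) σ < liebWuFilling Q ρ := by
  have hS : MeasurableSet (Icc (-B) B) := measurableSet_Icc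
  have h' := isLiebWuDensities_liebWuRhoAtS_liebWuSigmaAtS hU h.cutoff_pos h.cutoff_le_pi hB
  obtain ⟨hf, -, hd⟩ := IsLiebWuDensities.functionals_unique_on hU hS h h'
  rw [hf, hd]
  exact two_mul_downSpin_lt_filling_Icc hU h.cutoff_pos h.cutoff_le_pi B

/-- **Statement (b) for an arbitrary solution with `B = ∞`: `M/N = ½`.** [cite: LiebWuPRL1968, statement (b)] -/
theorem IsLiebWuDensities.two_mul_downSpin_eq_filling (hU : 0 < U) {ρ σ : ℝ → ℝ}
    (h : IsLiebWuDensities U Q univ ρ σ) : 2 * liebWuDownSpinDensity univ σ = liebWuFilling Q ρ := by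
  have h' := isLiebWuDensities_liebWuRhoAtS_of_range hU h.cutoff_pos h.cutoff_le_pi (Or.inr rfl)
  obtain ⟨hf, -, hd⟩ := IsLiebWuDensities.functionals_unique_on hU MeasurableSet.univ h h'
  rw [hf, hd]
  exact two_mul_downSpin_eq_filling_univ hU h.cutoff_pos h.cutoff_le_pi

/-! ### The tail integral: decreasing in `B` (Lemma 1) and vanishing as `B → ∞`; `M/N → ½` -/

/-- "The integrals in (lemma1) decrease as `B` increases by Lemma 1": for `B ≤ B'`,
`∫_{|Λ|>B'} σ_{B'} ≤ ∫_{|Λ|>B} σ_B`. [cite: LiebWuPhysicaA2003, §5, proof of Theorem 2] -/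
theorem tail_antitone (hU : 0 < U) (hQ : 0 < Q) {B B' : ℝ} (hBB' : B ≤ B') :
    ∫ Λ in (Icc (-B') B')ᶜ, liebWuSigmaAtS U Q (Icc (-B') B') Λ ≤
      ∫ Λ in (Icc (-B) B)ᶜ, liebWuSigmaAtS U Q (Icc (-B) B) Λ := by
  have hS : MeasurableSet (Icc (-B) B) := measurableSet_Icc
  have hS' : MeasurableSet (Icc (-B') B') := measurableSet_Icc
  have hσi := integrable_liebWuSigmaAtS hU hQ hS
  have hσ'i := integrable_liebWuSigmaAtS hU hQ hS'
  have hsub : (Icc (-B') B')ᶜ ⊆ (Icc (-B) B)ᶜ := compl_subset_compl.2 (Icc_subset_Icc (neg_le_neg hBB') hBB')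
  calc ∫ Λ in (Icc (-B') B')ᶜ, liebWuSigmaAtS U Q (Icc (-B') B') Λ
      ≤ ∫ Λ in (Icc (-B') B')ᶜ, liebWuSigmaAtS U Q (Icc (-B) B) Λ :=
        setIntegral_mono_on hσ'i.integrableOn hσi.integrableOn hS'.compl
          fun Λ _ => liebWuSigmaAtS_Icc_antitone hU hQ hBB' Λ
    _ ≤ ∫ Λ in (Icc (-B) B)ᶜ, liebWuSigmaAtS U Q (Icc (-B) B) Λ :=
        setIntegral_mono_set hσi.integrableOn
          (Eventually.of_forall fun t => (liebWuSigmaAtS_pos hU hQ hS t).le) (Eventually.of_forall hsub)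

/-- "… and converge to `0` as `B → ∞`": the tail integral of `σ_B` outside `[-B, B]` tends to zero
(dominated by the tail of the fixed integrable `σ_{B₀}`, Lemma 1). [cite: LiebWuPhysicaA2003, §5, proof of Theorem 2] -/
theorem tendsto_tail_zero (hU : 0 < U) (hQ : 0 < Q) :
    Tendsto (fun B : ℝ => ∫ Λ in (Icc (-B) B)ᶜ, liebWuSigmaAtS U Q (Icc (-B) B) Λ) atTop (𝓝 0) := by
  -- compare with the tail of `σ₁ = σ_{[-1,1]}` for `B ≥ 1`
  have hS1 : MeasurableSet (Icc (-(1:ℝ)) 1) := measurableSet_Icc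
  set σ₁ := liebWuSigmaAtS U Q (Icc (-(1:ℝ)) 1) with hσ₁
  have hσ₁i : Integrable σ₁ := integrable_liebWuSigmaAtS hU hQ hS1
  have htail₁ : Tendsto (fun B : ℝ => ∫ Λ in (Icc (-B) B)ᶜ, σ₁ Λ) atTop (𝓝 0) := by
    have hlim := intervalIntegral_tendsto_integral hσ₁i tendsto_neg_atTop_atBot tendsto_id
    have heq : ∀ B : ℝ, 0 ≤ B → ∫ Λ in (Icc (-B) B)ᶜ, σ₁ Λ = (∫ Λ, σ₁ Λ) - ∫ Λ in -B..B, σ₁ Λ := by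
      intro B hB
      rw [intervalIntegral.integral_of_le (by linarith), ← integral_Icc_eq_integral_Ioc,
        ← integral_add_compl (measurableSet_Icc : MeasurableSet (Icc (-B) B)) hσ₁i]
      ring
    have h0 : Tendsto (fun B : ℝ => (∫ Λ, σ₁ Λ) - ∫ Λ in -B..B, σ₁ Λ) atTop (𝓝 0) := by
      have := (tendsto_const_nhds (x := ∫ Λ, σ₁ Λ)).sub hlim
      rwa [sub_self] at this
    refine h0.congr' ?_
    filter_upwards [eventually_ge_atTop (0:ℝ)] with B hB
    exact (heq B hB).symm
  have hnonneg : ∀ B : ℝ, 0 ≤ ∫ Λ in (Icc (-B) B)ᶜ, liebWuSigmaAtS U Q (Icc (-B) B) Λ := fun B =>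
    setIntegral_nonneg measurableSet_Icc.compl fun t _ => (liebWuSigmaAtS_pos hU hQ measurableSet_Icc t).le
  refine tendsto_of_tendsto_of_tendsto_of_le_of_le' tendsto_const_nhds htail₁
    (Eventually.of_forall hnonneg) ?_
  filter_upwards [eventually_ge_atTop (1:ℝ)] with B hB
  exact setIntegral_mono_on (integrable_liebWuSigmaAtS hU hQ measurableSet_Icc).integrableOn hσ₁i.integrableOn
    measurableSet_Icc.compl fun Λ _ => liebWuSigmaAtS_Icc_antitone hU hQ hB Λ

/-- **Statement (b), the limit: `M/N → ½` as `B → ∞`** (`1 - 2M/N = (∫_{|Λ|>B} σ_B)/(N/N_a)` with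
`N/N_a ≥ Q/2π` and the tail `→ 0`). [cite: LiebWuPRL1968, statement (b)] -/
theorem tendsto_magnetisation_half (hU : 0 < U) (hQ : 0 < Q) (hQπ : Q ≤ π) :
    Tendsto (fun B : ℝ => liebWuDownSpinDensity (Icc (-B) B) (liebWuSigmaAtS U Q (Icc (-B) B)) /
      liebWuFilling Q (liebWuRhoAtS U Q (Icc (-B) B))) atTop (𝓝 (1 / 2)) := by
  have hq : 0 < Q / (2 * π) := by positivity
  set n : ℝ → ℝ := fun B => liebWuFilling Q (liebWuRhoAtS U Q (Icc (-B) B)) with hn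
  set μ : ℝ → ℝ := fun B => liebWuDownSpinDensity (Icc (-B) B) (liebWuSigmaAtS U Q (Icc (-B) B)) with hμ
  set τ : ℝ → ℝ := fun B => ∫ Λ in (Icc (-B) B)ᶜ, liebWuSigmaAtS U Q (Icc (-B) B) Λ with hτ
  have hnpos : ∀ B, Q / (2 * π) ≤ n B := fun B => liebWuFilling_liebWuRhoAtS_ge hU hQ hQπ measurableSet_Icc
  have hid : ∀ B, μ B / n B = 1 / 2 - τ B / (2 * n B) := by
    intro B
    have hnB : n B ≠ 0 := (hq.trans_le (hnpos B)).ne'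
    have h := two_mul_downSpin_add_tail (S := Icc (-B) B) hU hQ hQπ measurableSet_Icc
    field_simp
    simp only [hn, hμ, hτ] at h ⊢
    linarith
  have hτ0 : ∀ B, 0 ≤ τ B := fun B =>
    setIntegral_nonneg measurableSet_Icc.compl fun t _ => (liebWuSigmaAtS_pos hU hQ measurableSet_Icc t).le
  -- `0 ≤ τ/(2n) ≤ τ · (π/Q) → 0`
  have hupper : Tendsto (fun B => τ B * (π / Q)) atTop (𝓝 0) := by
    have := (tendsto_tail_zero hU hQ).mul_const (π / Q)
    rwa [zero_mul] at this
  have hquot : Tendsto (fun B => τ B / (2 * n B)) atTop (𝓝 0) := by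
    refine tendsto_of_tendsto_of_tendsto_of_le_of_le' tendsto_const_nhds hupper
      (Eventually.of_forall fun B => div_nonneg (hτ0 B) (by linarith [hnpos B, hq])) (Eventually.of_forall fun B => ?_)
    have hnB : 0 < n B := hq.trans_le (hnpos B)
    rw [div_le_iff₀ (by linarith)]
    have : τ B * (π / Q) * (2 * n B) = τ B * (n B / (Q / (2 * π))) := by
      field_simp
    rw [this]
    have h1 : 1 ≤ n B / (Q / (2 * π)) := by rw [le_div_iff₀ hq]; linarith [hnpos B]
    calc τ B = τ B * 1 := (mul_one _).symm
      _ ≤ τ B * (n B / (Q / (2 * π))) := mul_le_mul_of_nonneg_left h1 (hτ0 B)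
  have h := (tendsto_const_nhds (x := (1:ℝ) / 2)).sub hquot
  rw [sub_zero] at h
  exact h.congr fun B => (hid B).symm

end Theorem2

end Literature.MathematicalPhysics.QuantumLattice

end
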